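import Summits.Ventures.CertifiedManyBodySolver.Rows.CARPolyWindowGramTwoLevel
import HarnessLib

/-!
# The CONTRACTED two-level Gram list: ONE CAR product per raw word pair, with the integer Gram entries summed ACROSS the
# symmetry-adapted copies that contain the pair — TRUST-FREE (the pair list is exporter data, checked by validity + sortedness +
# a COUNT), PSD by construction INHERITED from `gramTB`

HONEST FRAMING: Lean plumbing towards «tier P» (HOME/STATUS «ANSWER (R0′)» 23:28:38Z). MEASURED by sdp-1 g3 on the Rm2 hub certificate:
the per-copy two-level Gram form (`gramTB`, one block per adapted copy) normal-orders 3 778 144 word products per certificate, but only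
361 926 DISTINCT raw pairs occur — each raw pair lies in ≈ 8 copies of DIFFERENT irrep families. This file sums the integer Gram
entries of a pair over its copies FIRST (short integer dot products) and multiplies the pair ONCE. Data: a WORD TABLE
`words : List (Terms α × List (ℕ × List ℤ))` — each raw basis polynomial with its (copy, integer row) memberships — and the exporter's
PAIR LIST `P : List (ℕ × ℕ × List ℕ)` — `(a, b, ks)` = «pair `(a, b)` occurs exactly in the copies `ks`». The kernel emits
`gramContract K words P = Σ_{(a,b,ks) ∈ P} (Σ_{k ∈ ks} idot r^k_a r^k_b / 4^K) · v_a† v_b` and the instance proves three DECIDABLE facts: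
VALIDITY (`ValidP`: every listed copy contains both words, indices in range), SORTEDNESS (`SortedP`: the incidence keys strictly
increase — hence no incidence is listed twice) and the COUNT (`CountP`: the number of listed incidences equals `Σ_k n_k²`, `n_k` = number
of words in copy `k`). A duplicate-free subset of the finite incidence set `{(a, b, k) : a, b ∈ copy k}` with its full cardinality IS
that set, so **`termOp_gramContract`**: the contracted list denotes EXACTLY what the per-copy block list `copyBlocks words Kc` denotes
through `gramTB` — a `gramForm` with a positive-semidefinite coefficient matrix (`termOp_gramTB_eq_gramForm`, `gramTBCoef_posSemidef`), no
property of the exporter's data being trusted. Boolean checkers `validB` / `sortedB` / `countB` with soundness lemmas make the three facts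
`decide`-able (chunkable: all three are conjunctions / sums over `P`). Nothing of record moves; no certificate is evaluated here;
CONTROL/CALIBRATION context (wording (xx1)); no summit statement is proved by this file. Seat hubbard-obs-p2 (STIFFNESS),
`prover-hubbard-obs-p2-g23-0`, zero compute.

References: X. Han, arXiv:2006.06002 §2 eq. (2), §3 (Gram family; symmetry-adapted blocks) [Han2020Bootstrap]; J. Wang et al., PRX 14
(2024) 031006 §III [WangEtAl2024]; C. Jansson, D. Chaykin, C. Keil, SIAM J. Numer. Anal. 46 (2008) 180 [JanssonChaykinKeil2008].
-/

namespace Summit.Ventures.CertifiedManyBodySolver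

namespace CARPolyWindow

open Summit.Ventures.CertifiedQuantumChemistry Summit.Ventures.CertifiedQuantumChemistry.CARPoly
open Literature.MathematicalPhysics.QuantumManyBody.StateRelaxation
open Matrix
open scoped ComplexOrder BigOperators

/-! ## §1 Data and the computable contracted list -/

section Data

variable {α : Type*}

/-- The word table: basis polynomial + its `(copy, integer row)` memberships. [cite: Han2020Bootstrap, §3] -/
abbrev WordTable (α : Type*) := List (Terms α × List (ℕ × List ℤ))

/-- The basis polynomial of word `a` (empty if out of range). [folklore] -/
def polyOf (words : WordTable α) (a : ℕ) : Terms α := (words.getD a ([], [])).1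

/-- The memberships of word `a`. [folklore] -/
def membOf (words : WordTable α) (a : ℕ) : List (ℕ × List ℤ) := (words.getD a ([], [])).2

/-- Is word `a` in copy `k`? [folklore] -/
def inCopy (words : WordTable α) (a k : ℕ) : Bool := (membOf words a).any fun e => e.1 == k

/-- The integer row of word `a` in copy `k` (empty if absent). [folklore] -/
def rowOf (words : WordTable α) (a k : ℕ) : List ℤ :=
  match (membOf words a).find? fun e => e.1 == k with
  | some e => e.2
  | none => []

/-- The words of copy `k`, in table order. [folklore] -/
def wordsIn (words : WordTable α) (k : ℕ) : List ℕ := (List.range words.length).filter fun a => inCopy words a k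

/-- The per-copy block `k`: `(row, polynomial)` of its words. [cite: Han2020Bootstrap, §2 eq. (2)] -/
def copyBlock (words : WordTable α) (k : ℕ) : List (List ℤ × Terms α) := (wordsIn words k).map fun a => (rowOf words a k, polyOf words a)

/-- All per-copy blocks `0 … Kc−1` (the input of the landed `gramTB`). [cite: Han2020Bootstrap, §2 eq. (2)] -/
def copyBlocks (words : WordTable α) (Kc : ℕ) : List (List (List ℤ × Terms α)) := (List.range Kc).map (copyBlock words)

/-- The contracted integer coefficient of a pair over the listed copies. [folklore] -/
def coefSum (words : WordTable α) (a b : ℕ) (ks : List ℕ) : ℤ := (ks.map fun k => idot (rowOf words a k) (rowOf words b k)).sum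

/-- **The CONTRACTED Gram list**: one product per listed pair. [cite: Han2020Bootstrap, §2 eq. (2)] [cite: WangEtAl2024, §III] -/
def gramContract (K : ℕ) (words : WordTable α) (P : List (ℕ × ℕ × List ℕ)) : Terms α :=
  P.flatMap fun e => scaleT ((coefSum words e.1 e.2.1 e.2.2 : ℚ) / 4 ^ K) (mulT (daggerT (polyOf words e.1)) (polyOf words e.2.1))

/-- The contracted Gram list SLICED one pair per slice (regroup with `groupSlices`). [folklore] -/
def gramContractSlices (K : ℕ) (words : WordTable α) (P : List (ℕ × ℕ × List ℕ)) : List (Terms α) :=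
  P.map fun e => scaleT ((coefSum words e.1 e.2.1 e.2.2 : ℚ) / 4 ^ K) (mulT (daggerT (polyOf words e.1)) (polyOf words e.2.1))

/-- The slices re-assemble the contracted list. [folklore] -/
theorem flatten_gramContractSlices (K : ℕ) (words : WordTable α) (P : List (ℕ × ℕ × List ℕ)) :
    (gramContractSlices K words P).flatten = gramContract K words P := by
  rw [gramContractSlices, gramContract]
  induction P with
  | nil => rfl
  | cons e P ih => rw [List.map_cons, List.flatten_cons, List.flatMap_cons, ih]

/-- The incidence key of `(a, b, k)`. [folklore] -/
def incKey (W Kc : ℕ) (a b k : ℕ) : ℕ := (a * W + b) * Kc + k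

/-- The listed incidences `(a, b, k)`, in order. [folklore] -/
def incid (P : List (ℕ × ℕ × List ℕ)) : List (ℕ × ℕ × ℕ) := P.flatMap fun e => e.2.2.map fun k => (e.1, e.2.1, k)

/-- The FULL incidence list `{(a, b, k) : k < Kc, a, b ∈ copy k}` (never evaluated; the reference the count is checked against). [folklore] -/
def fullIncid (words : WordTable α) (Kc : ℕ) : List (ℕ × ℕ × ℕ) :=
  (List.range Kc).flatMap fun k => (wordsIn words k).flatMap fun a => (wordsIn words k).map fun b => (a, b, k)

end Data

/-! ## §2 The three facts and their Boolean checkers -/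

section Checks

variable {α : Type*}

/-- VALIDITY: every listed incidence has its indices in range and its copy containing both words. [folklore] -/
def ValidP (words : WordTable α) (Kc : ℕ) (P : List (ℕ × ℕ × List ℕ)) : Prop :=
  ∀ t ∈ incid P, t.1 < words.length ∧ t.2.1 < words.length ∧ t.2.2 < Kc ∧
    inCopy words t.1 t.2.2 = true ∧ inCopy words t.2.1 t.2.2 = true

/-- SORTEDNESS: the incidence keys strictly increase. [folklore] -/
def SortedP (W Kc : ℕ) (P : List (ℕ × ℕ × List ℕ)) : Prop :=
  ((incid P).map fun t => incKey W Kc t.1 t.2.1 t.2.2).Pairwise (· < ·)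

/-- COUNT: as many listed incidences as `Σ_k n_k²`. [folklore] -/
def CountP (words : WordTable α) (Kc : ℕ) (P : List (ℕ × ℕ × List ℕ)) : Prop :=
  (P.map fun e => e.2.2.length).sum = ((List.range Kc).map fun k => (wordsIn words k).length * (wordsIn words k).length).sum

/-- Boolean validity check. [folklore] -/
def validB (words : WordTable α) (Kc : ℕ) (P : List (ℕ × ℕ × List ℕ)) : Bool :=
  P.all fun e => decide (e.1 < words.length) && decide (e.2.1 < words.length) &&
    e.2.2.all fun k => decide (k < Kc) && inCopy words e.1 k && inCopy words e.2.1 k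

/-- Strict increase of a list of keys (adjacent comparisons). [folklore] -/
def incrB : List ℕ → Bool
  | [] => true
  | [_] => true
  | a :: b :: l => decide (a < b) && incrB (b :: l)

/-- Boolean sortedness check. [folklore] -/
def sortedB (W Kc : ℕ) (P : List (ℕ × ℕ × List ℕ)) : Bool := incrB ((incid P).map fun t => incKey W Kc t.1 t.2.1 t.2.2)

/-- Boolean count check. [folklore] -/
def countB (words : WordTable α) (Kc : ℕ) (P : List (ℕ × ℕ × List ℕ)) : Bool :=
  decide ((P.map fun e => e.2.2.length).sum = ((List.range Kc).map fun k => (wordsIn words k).length * (wordsIn words k).length).sum)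

/-- `validB` is sound. [folklore] -/
theorem validP_of_validB (words : WordTable α) (Kc : ℕ) (P : List (ℕ × ℕ × List ℕ)) (h : validB words Kc P = true) :
    ValidP words Kc P := by
  intro t ht
  rw [incid, List.mem_flatMap] at ht
  obtain ⟨e, he, hte⟩ := ht
  rw [List.mem_map] at hte
  obtain ⟨k, hk, rfl⟩ := hte
  simp only [validB, List.all_eq_true, Bool.and_eq_true, decide_eq_true_eq] at h
  obtain ⟨⟨ha, hb⟩, hks⟩ := h e he
  obtain ⟨⟨hk', hia⟩, hib⟩ := hks k hk
  exact ⟨ha, hb, hk', hia, hib⟩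

/-- `incrB` is sound: adjacent strictness gives pairwise strictness. [folklore] -/
theorem pairwise_of_incrB : ∀ l : List ℕ, incrB l = true → l.Pairwise (· < ·)
  | [], _ => List.Pairwise.nil
  | [a], _ => List.pairwise_singleton _ _
  | a :: b :: l, h => by
    simp only [incrB, Bool.and_eq_true, decide_eq_true_eq] at h
    have ih := pairwise_of_incrB (b :: l) h.2
    refine List.Pairwise.cons ?_ ih
    intro x hx
    rcases List.mem_cons.1 hx with rfl | hx
    · exact h.1
    · exact lt_trans h.1 (List.rel_of_pairwise_cons ih hx)

/-- `sortedB` is sound. [folklore] -/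
theorem sortedP_of_sortedB (W Kc : ℕ) (P : List (ℕ × ℕ × List ℕ)) (h : sortedB W Kc P = true) : SortedP W Kc P :=
  pairwise_of_incrB _ h

/-- `countB` is sound. [folklore] -/
theorem countP_of_countB (words : WordTable α) (Kc : ℕ) (P : List (ℕ × ℕ × List ℕ)) (h : countB words Kc P = true) :
    CountP words Kc P := by
  unfold countB at h
  unfold CountP
  exact of_decide_eq_true h

end Checks

/-! ## §3 The incidence argument -/

section Incidence

variable {α : Type*}

/-- The listed incidences are distinct (strictly increasing keys). [folklore] -/
theorem nodup_incid {W Kc : ℕ} {P : List (ℕ × ℕ × List ℕ)} (hs : SortedP W Kc P) : (incid P).Nodup := by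
  have hk : ((incid P).map fun t => incKey W Kc t.1 t.2.1 t.2.2).Nodup := hs.imp fun h => Nat.ne_of_lt h
  exact hk.of_map _

/-- The number of listed incidences is `Σ_e |ks_e|`. [folklore] -/
theorem length_incid (P : List (ℕ × ℕ × List ℕ)) : (incid P).length = (P.map fun e => e.2.2.length).sum := by
  induction P with
  | nil => rfl
  | cons e P ih => rw [incid, List.flatMap_cons, List.length_append, List.length_map, ← incid, ih, List.map_cons, List.sum_cons]

/-- Length of a product-like `flatMap`. [folklore] -/
theorem length_flatMap_map {γ δ ε : Type*} (A : List γ) (B : List δ) (f : γ → δ → ε) :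
    (A.flatMap fun a => B.map (f a)).length = A.length * B.length := by
  induction A with
  | nil => simp
  | cons a A ih => rw [List.flatMap_cons, List.length_append, List.length_map, ih, List.length_cons]; ring

/-- The length of the full incidence list is `Σ_k n_k²`. [folklore] -/
theorem length_fullIncid (words : WordTable α) (Kc : ℕ) :
    (fullIncid words Kc).length = ((List.range Kc).map fun k => (wordsIn words k).length * (wordsIn words k).length).sum := by
  rw [fullIncid]
  induction (List.range Kc) with
  | nil => rfl
  | cons k L ih => rw [List.flatMap_cons, List.length_append, ih, List.map_cons, List.sum_cons, length_flatMap_map]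

/-- `wordsIn` lists are duplicate-free. [folklore] -/
theorem nodup_wordsIn (words : WordTable α) (k : ℕ) : (wordsIn words k).Nodup := (List.nodup_range).filter _

/-- Membership in `wordsIn`. [folklore] -/
theorem mem_wordsIn {words : WordTable α} {k a : ℕ} : a ∈ wordsIn words k ↔ a < words.length ∧ inCopy words a k = true := by
  simp [wordsIn, List.mem_filter, List.mem_range]

/-- The full incidence list is duplicate-free. [folklore] -/
theorem nodup_fullIncid (words : WordTable α) (Kc : ℕ) : (fullIncid words Kc).Nodup := by
  rw [fullIncid, List.nodup_flatMap]
  constructor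
  · intro k _
    rw [List.nodup_flatMap]
    constructor
    · intro a _
      exact (nodup_wordsIn words k).map fun b b' h => (Prod.mk.inj (Prod.mk.inj h).2).1
    · refine (nodup_wordsIn words k).pairwise_of_forall_ne ?_
      intro a _ a' _ hne
      rw [Function.onFun, List.disjoint_left]
      intro t ht ht'
      rw [List.mem_map] at ht ht'
      obtain ⟨b, _, rfl⟩ := ht
      obtain ⟨b', _, h⟩ := ht'
      exact hne (Prod.mk.inj h).1.symm
  · refine (List.nodup_range).pairwise_of_forall_ne ?_
    intro k _ k' _ hne
    rw [Function.onFun, List.disjoint_left]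
    intro t ht ht'
    rw [List.mem_flatMap] at ht ht'
    obtain ⟨a, _, hta⟩ := ht
    obtain ⟨a', _, hta'⟩ := ht'
    rw [List.mem_map] at hta hta'
    obtain ⟨b, _, rfl⟩ := hta
    obtain ⟨b', _, h⟩ := hta'
    exact hne (Prod.mk.inj (Prod.mk.inj h).2).2.symm

/-- Validity puts every listed incidence in the full list. [folklore] -/
theorem incid_subset_fullIncid {words : WordTable α} {Kc : ℕ} {P : List (ℕ × ℕ × List ℕ)} (hv : ValidP words Kc P) :
    ∀ t ∈ incid P, t ∈ fullIncid words Kc := by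
  intro t ht
  obtain ⟨ha, hb, hk, hia, hib⟩ := hv t ht
  obtain ⟨a, b, k⟩ := t
  rw [fullIncid, List.mem_flatMap]
  refine ⟨k, List.mem_range.2 hk, ?_⟩
  rw [List.mem_flatMap]
  refine ⟨a, mem_wordsIn.2 ⟨ha, hia⟩, ?_⟩
  rw [List.mem_map]
  exact ⟨b, mem_wordsIn.2 ⟨hb, hib⟩, rfl⟩

/-- **The incidence argument**: valid + sorted + counted ⇒ the listed incidences are a PERMUTATION of the full incidence list.
[folklore] -/
theorem incid_perm_fullIncid {words : WordTable α} {Kc : ℕ} {P : List (ℕ × ℕ × List ℕ)} (hv : ValidP words Kc P)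
    (hs : SortedP words.length Kc P) (hc : CountP words Kc P) : (incid P).Perm (fullIncid words Kc) := by
  classical
  have hnd1 := nodup_incid hs
  have hnd2 := nodup_fullIncid words Kc
  have hsub : (incid P).toFinset ⊆ (fullIncid words Kc).toFinset := by
    intro t ht
    rw [List.mem_toFinset] at ht ⊢
    exact incid_subset_fullIncid hv t ht
  have hcard : (fullIncid words Kc).toFinset.card ≤ (incid P).toFinset.card := by
    rw [List.toFinset_card_of_nodup hnd1, List.toFinset_card_of_nodup hnd2, length_incid, length_fullIncid]
    exact le_of_eq hc.symm
  have heq : (incid P).toFinset = (fullIncid words Kc).toFinset := Finset.eq_of_subset_of_card_le hsub hcard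
  exact (List.perm_ext_iff_of_nodup hnd1 hnd2).2 fun t => by
    rw [← List.mem_toFinset, ← List.mem_toFinset, heq]

end Incidence

/-! ## §4 Semantics: the contracted list denotes the per-copy `gramTB` -/

section Semantics

variable {α : Type*} {ι : Type*} [LinearOrder ι] [Fintype ι]

/-- The operator one incidence contributes. [folklore] -/
noncomputable def incOp (d : α → ι) (K : ℕ) (words : WordTable α) (t : ℕ × ℕ × ℕ) : Matrix (Finset ι) (Finset ι) ℂ :=
  ((((idot (rowOf words t.1 t.2.2) (rowOf words t.2.1 t.2.2) : ℚ) / 4 ^ K : ℚ)) : ℂ) •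
    ((termOp d (polyOf words t.1))ᴴ * termOp d (polyOf words t.2.1))

/-- A list sum through a `flatMap`. [folklore] -/
theorem sum_map_flatMap {γ δ : Type*} {M : Type*} [AddCommMonoid M] (L : List γ) (F : γ → List δ) (g : δ → M) :
    ((L.flatMap F).map g).sum = (L.map fun x => ((F x).map g).sum).sum := by
  induction L with
  | nil => rfl
  | cons x L ih => rw [List.flatMap_cons, List.map_append, List.sum_append, ih, List.map_cons, List.sum_cons]

/-- One contracted entry denotes the sum of its incidences. [folklore] -/
theorem termOp_contractEntry (d : α → ι) (K : ℕ) (words : WordTable α) (a b : ℕ) (ks : List ℕ) :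
    termOp d (scaleT ((coefSum words a b ks : ℚ) / 4 ^ K) (mulT (daggerT (polyOf words a)) (polyOf words b))) =
      ((ks.map fun k => (a, b, k)).map (incOp d K words)).sum := by
  rw [termOp_scaleT, termOp_mulT, termOp_daggerT, List.map_map]
  induction ks with
  | nil => simp [coefSum]
  | cons k ks ih =>
    rw [List.map_cons, List.sum_cons, ← ih]
    simp only [coefSum, List.map_cons, List.sum_cons, Function.comp_apply, incOp]
    rw [Int.cast_add, add_div, Rat.cast_add, add_smul]

/-- **The contracted list denotes the sum of its listed incidences.** [folklore] -/
theorem termOp_gramContract_eq_sum (d : α → ι) (K : ℕ) (words : WordTable α) (P : List (ℕ × ℕ × List ℕ)) :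
    termOp d (gramContract K words P) = ((incid P).map (incOp d K words)).sum := by
  rw [gramContract, termOp_flatMap, incid, sum_map_flatMap]
  congr 1
  refine List.map_congr_left fun e _ => ?_
  exact termOp_contractEntry d K words e.1 e.2.1 e.2.2

/-- **The per-copy two-level Gram list denotes the sum over the FULL incidence list.** [cite: Han2020Bootstrap, §2 eq. (2)] -/
theorem termOp_gramTB_copyBlocks_eq_sum (d : α → ι) (K : ℕ) (words : WordTable α) (Kc : ℕ) :
    termOp d (gramTB K (copyBlocks words Kc)) = ((fullIncid words Kc).map (incOp d K words)).sum := by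
  rw [gramTB, termOp_flatMap, copyBlocks, List.map_map, fullIncid, sum_map_flatMap]
  congr 1
  refine List.map_congr_left fun k _ => ?_
  show termOp d (gramTB1 K (copyBlock words k)) = _
  rw [gramTB1, termOp_flatMap, copyBlock, List.map_map, sum_map_flatMap]
  congr 1
  refine List.map_congr_left fun a _ => ?_
  show termOp d ((List.map (fun a => (rowOf words a k, polyOf words a)) (wordsIn words k)).flatMap fun b =>
      scaleT ((idot (rowOf words a k) b.1 : ℚ) / 4 ^ K) (mulT (daggerT (polyOf words a)) b.2)) = _
  rw [termOp_flatMap, List.map_map, List.map_map]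
  congr 1
  refine List.map_congr_left fun b _ => ?_
  show termOp d (scaleT ((idot (rowOf words a k) (rowOf words b k) : ℚ) / 4 ^ K) (mulT (daggerT (polyOf words a)) (polyOf words b))) = _
  rw [termOp_scaleT, termOp_mulT, termOp_daggerT]
  rfl

/-- **THE CONTRACTION THEOREM**: valid + sorted + counted ⇒ the contracted Gram list denotes EXACTLY the per-copy two-level Gram list
(hence a `gramForm` with a PSD coefficient matrix, by `termOp_gramTB_eq_gramForm` / `gramTBCoef_posSemidef`). [cite: Han2020Bootstrap, §2 eq. (2)]
[cite: WangEtAl2024, §III] -/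
theorem termOp_gramContract {d : α → ι} (K : ℕ) (words : WordTable α) (Kc : ℕ) (P : List (ℕ × ℕ × List ℕ))
    (hv : ValidP words Kc P) (hs : SortedP words.length Kc P) (hc : CountP words Kc P) :
    termOp d (gramContract K words P) = termOp d (gramTB K (copyBlocks words Kc)) := by
  rw [termOp_gramContract_eq_sum, termOp_gramTB_copyBlocks_eq_sum]
  exact ((incid_perm_fullIncid hv hs hc).map _).sum_eq

/-- **The contracted slices denote a PSD `gramForm`** (the `hTG` hypothesis of the abstract-Gram closers). [cite: WangEtAl2024, §III] -/
theorem termOp_flatten_gramContractSlices {d : α → ι} (K : ℕ) (words : WordTable α) (Kc : ℕ) (P : List (ℕ × ℕ × List ℕ))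
    (hv : ValidP words Kc P) (hs : SortedP words.length Kc P) (hc : CountP words Kc P) :
    termOp d (gramContractSlices K words P).flatten =
      gramForm (gramTBCoef K (copyBlocks words Kc)) (gramTBOp d (copyBlocks words Kc)) := by
  rw [flatten_gramContractSlices, termOp_gramContract K words Kc P hv hs hc, termOp_gramTB_eq_gramForm]

end Semantics

end CARPolyWindow

end Summit.Ventures.CertifiedManyBodySolver
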